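import Literature.NumberTheory.Automorphic.QuaternionLocalRamifiedStructure
import HarnessLib

/-!
# The trace dual of the maximal order at a ramified prime is `π⁻¹ O₍ₚ₎`, of index `p²`
# (Vignéras, LNM 800, Ch. II §1 Cor. 1.7: "la différente `O♯⁻¹` de `O` est `P = Oπ`")

Topic `NumberTheory/Automorphic`; theorems only (no definition, no named fact, no instance).
For a `ℤ`-order `O` of a division quaternion algebra `B` over `ℚ` whose localisation at the
prime `p` is the norm-valuation ring, `O₍ₚ₎ = {x | nrd x ∈ ℤ₍ₚ₎}` (the maximal orders at a
ramified prime, `QuaternionLocalRamified.lean`), and `ℚ_p ⊗ B` a division ring: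

* `exists_padicValRat_reducedTrace_eq_zero_of_ramified` — **there is `y ∈ O₍ₚ₎` with
  `v_p(trd y) = 0`** (`y = 1` for odd `p`; for `p = 2`: `O₍₂₎ / π O₍₂₎ ≅ 𝔽₄` is larger than the
  image `𝔽₂` of `ℤ₍₂₎`, and an element outside `ℤ₍₂₎ + π O₍₂₎` of even trace `t` would give
  `z = y - t/2` with `z² ∈ ℤ₍₂₎ˣ`, `nrd(z + 1) = nrd z + 1 ≡ 0`, `z ∈ -1 + π O₍₂₎`, absurd).
* `forall_not_dvd_den_reducedTrace_iff_of_ramified` — **the local trace dual is `π⁻¹ O₍ₚ₎`**: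
  `trd(x y) ∈ ℤ₍ₚ₎` for all `y ∈ O₍ₚ₎` iff `x ∈ π⁻¹ O₍ₚ₎` (`⇐` from `2 v_p(trd) ≥ v_p(nrd) ≥ -1`;
  `⇒`: if `v_p(nrd x) ≤ -2` then `y = p⁻¹ x⁻¹ y₀ ∈ O₍ₚ₎` has `trd(x y) = trd(y₀)/p`).
* `relIndex_localAt_inv_uniformizer_smul` — **`[π⁻¹ O₍ₚ₎ : O₍ₚ₎] = p²`** (Cor. 1.7: the reduced
  discriminant of `O_p` is `p`, its discriminant `p²`).

These give the factor `p²` at each ramified prime of the discriminant `[O₁♯ : O₁] = (N⁻)²` of a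
maximal order, i.e. the covolume of the maximal orders in Eichler's mass formula
(`brandtModule_massFormula`).

## References

* M.-F. Vignéras, *Arithmétique des algèbres de quaternions*, LNM 800 (1980), Ch. II §1
  Lemme 1.4, Cor. 1.7; Ch. I §4 Lemme 4.7 [VignerasLNM800].
* J. Voight, *Quaternion Algebras*, GTM 288 (2021), Lemma 15.2.15, Example 15.2.12, 15.6.
-/

noncomputable section

open scoped TensorProduct Pointwise

universe u

namespace Literature.NumberTheory.Automorphic

variable {B : Type u} [Ring B] [Algebra ℚ B] [IsQuaternionAlgebra ℚ B] {p : ℕ} [hp : Fact p.Prime]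

/-! ### A `p`-integral rational of valuation `0` plus `1` has valuation `≥ 1` at `p = 2` -/

/-- For a `2`-integral rational `q` with `v₂(q) = 0` (odd numerator and denominator), `q + 1`
is `0` or has `v₂(q + 1) ≥ 1`. [folklore] -/
theorem padicValRat_two_add_one {q : ℚ} (hq : ¬ 2 ∣ q.den) (hv : padicValRat 2 q = 0) (hq0 : q ≠ 0) :
    q + 1 = 0 ∨ 1 ≤ padicValRat 2 (q + 1) := by
  have hden0 : (q.den : ℤ) ≠ 0 := by exact_mod_cast q.den_ne_zero
  have hvnum : padicValInt 2 q.num = 0 := by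
    have h := padicValRat_def 2 q
    rw [hv, padicValNat.eq_zero_of_not_dvd hq, Nat.cast_zero, sub_zero] at h
    exact_mod_cast h.symm
  have hnum_odd : ¬ (2 : ℤ) ∣ q.num := by
    intro h
    rcases (padicValInt_dvd_iff 1 q.num).mp (by rwa [pow_one]) with h0 | h1
    · exact Rat.num_ne_zero.mpr hq0 h0
    · rw [hvnum] at h1; exact absurd h1 (by norm_num)
  have hden_odd : ¬ (2 : ℤ) ∣ (q.den : ℤ) := by exact_mod_cast hq
  have hsum : (2 : ℤ) ∣ q.num + q.den := by
    have h1 := Int.emod_two_eq_zero_or_one q.num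
    have h2 := Int.emod_two_eq_zero_or_one (q.den : ℤ)
    rw [Int.dvd_iff_emod_eq_zero] at hnum_odd hden_odd ⊢
    omega
  have hq1 : q + 1 = ((q.num + q.den : ℤ) : ℚ) / (q.den : ℚ) := by
    conv_lhs => rw [← Rat.num_div_den q]
    field_simp
    push_cast
    ring
  by_cases hs : q.num + q.den = 0
  · left
    rw [hq1, hs]; simp
  · right
    rw [hq1, padicValRat.div (by exact_mod_cast hs) (by exact_mod_cast q.den_ne_zero), padicValRat.of_int,
      padicValRat.of_nat, padicValNat.eq_zero_of_not_dvd hq]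
    simp only [Nat.cast_zero, sub_zero]
    have := (padicValInt_dvd_iff 1 (q.num + q.den)).mp (by rwa [pow_one])
    rcases this with h | h
    · exact absurd h hs
    · exact_mod_cast h

/-! ### An element of `O₍ₚ₎` of trace a `p`-adic unit -/

section Ramified

variable (hdiv : ∀ x : B, x ≠ 0 → IsUnit x) {O : Submodule ℤ B} (hO : IsZOrder O)
  (hΛ : ∀ x : B, x ∈ localAt p O ↔ ¬ p ∣ (reducedNorm ℚ B x).den)
include hdiv hO hΛ

omit hO in
/-- `c • 1 ∈ ℤ • 1 + π O₍ₚ₎` for a `p`-integral rational `c` (as `p ∈ π O₍ₚ₎`): here in the form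
`c • 1 - c' • 1 ∈ π O₍ₚ₎` for some integer `c'`. [folklore] -/
theorem exists_int_smul_one_sub_mem_of_ramified (π : Bˣ) (hπ : padicValRat p (reducedNorm ℚ B (π : B)) = 1)
    {c : ℚ} (hc : ¬ p ∣ c.den) : ∃ c' : ℤ, c • (1 : B) - (c' : ℤ) • (1 : B) ∈ π • localAt p O := by
  have hpp : p.Prime := hp.out
  haveI : Nontrivial B := IsQuaternionAlgebra.nontrivial_rat
  -- `c = num / den` with `den` invertible modulo `p`: `den * d' ≡ 1 (mod p)`
  have hcop : Nat.Coprime c.den p := (Nat.Prime.coprime_iff_not_dvd hpp).mpr hc |>.symm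
  obtain ⟨d', hd'⟩ : ∃ d' : ℤ, (p : ℤ) ∣ (c.den : ℤ) * d' - 1 := by
    have h := Int.gcd_eq_gcd_ab (c.den : ℤ) p
    rw [Int.gcd_natCast_natCast, hcop.gcd_eq_one, Nat.cast_one] at h
    refine ⟨Int.gcdA (c.den : ℤ) p, ⟨-Int.gcdB (c.den : ℤ) p, ?_⟩⟩
    linear_combination (-1 : ℤ) * h
  refine ⟨c.num * d', ?_⟩
  obtain ⟨k, hk⟩ := hd'
  have hck : (c.den : ℚ) * d' - 1 = p * k := by exact_mod_cast hk
  -- `c - c' = -c (den d' - 1) = -c p k`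
  have hsc : c - ((c.num * d' : ℤ) : ℚ) = -(c * ((p * k : ℤ) : ℚ)) := by
    push_cast
    rw [show ((c.num : ℤ) : ℚ) = c * (c.den : ℚ) from (Rat.mul_den_eq_num c).symm]
    linear_combination (-c) * hck
  have hval : c • (1 : B) - ((c.num * d' : ℤ)) • (1 : B) = (-(c * ((p * k : ℤ) : ℚ))) • (1 : B) := by
    rw [← Int.cast_smul_eq_zsmul ℚ, ← sub_smul, hsc]
  rw [hval, mem_units_smul_localAt_iff_of_ramified hdiv hΛ, hπ]
  by_cases hc0 : c = 0
  · left; rw [hc0]; simp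
  by_cases hk0 : k = 0
  · left; rw [hk0]; simp
  right
  have hpk0 : ((p * k : ℤ) : ℚ) ≠ 0 := by exact_mod_cast mul_ne_zero (Int.natCast_ne_zero.mpr hpp.ne_zero) hk0
  rw [← Algebra.algebraMap_eq_smul_one, reducedNorm_algebraMap, padicValRat.pow, padicValRat.neg,
    padicValRat.mul hc0 hpk0, padicValRat.of_int]
  have h1 : 0 ≤ padicValRat p c := padicValRat_nonneg_of_not_dvd_den hc
  have h2 : 1 ≤ padicValInt p (p * k) := by
    rcases (padicValInt_dvd_iff 1 ((p : ℤ) * k)).mp (by rw [pow_one]; exact dvd_mul_right _ _) with h | h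
    · exact absurd h (mul_ne_zero (Int.natCast_ne_zero.mpr hpp.ne_zero) hk0)
    · exact h
  have h2' : (1 : ℤ) ≤ (padicValInt p (p * k) : ℤ) := by exact_mod_cast h2
  push_cast
  linarith

/-- **An element of trace a `p`-adic unit exists in `O₍ₚ₎`** at a ramified prime (`1` if `p` is
odd; at `p = 2` see the module docstring — the residue field `O₍₂₎ / π O₍₂₎` has `4 > 2`
elements). [cite: VignerasLNM800, Ch. II §1 Cor. 1.7] -/
theorem exists_padicValRat_reducedTrace_eq_zero_of_ramified :
    ∃ y ∈ localAt p O, reducedTrace ℚ B y ≠ 0 ∧ padicValRat p (reducedTrace ℚ B y) = 0 := by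
  classical
  have hpp : p.Prime := hp.out
  haveI : Nontrivial B := IsQuaternionAlgebra.nontrivial_rat
  by_cases hp2 : p ≠ 2
  · refine ⟨1, hO.one_mem_localAt, ?_, ?_⟩
    · rw [reducedTrace_one]; norm_num
    · rw [reducedTrace_one, show (2 : ℚ) = ((2 : ℕ) : ℚ) by norm_num, padicValRat.of_nat, Nat.cast_eq_zero,
        padicValNat.eq_zero_of_not_dvd]
      intro h
      exact hp2 ((Nat.prime_dvd_prime_iff_eq hpp Nat.prime_two).mp h)
  push Not at hp2
  subst hp2
  obtain ⟨π, hπΛ, hπ⟩ := exists_uniformizer_of_ramified hdiv hO hΛ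
  by_contra hnone
  push Not at hnone
  -- every trace in `O₍₂₎` is even: `trd y / 2` is `2`-integral
  have heven : ∀ y ∈ localAt 2 O, ¬ 2 ∣ ((reducedTrace ℚ B y) / 2).den := by
    intro y hy
    have hint := hO.not_dvd_den_reducedTrace_of_mem_localAt hy
    by_cases ht : reducedTrace ℚ B y = 0
    · rw [ht, zero_div, ← Int.cast_zero (R := ℚ)]; exact not_dvd_den_intCast Nat.prime_two 0
    have hv := hnone y hy ht
    have hv0 : 0 ≤ padicValRat 2 (reducedTrace ℚ B y) := padicValRat_nonneg_of_not_dvd_den hint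
    refine not_dvd_den_of_padicValRat_nonneg ?_
    rw [padicValRat.div ht two_ne_zero, show (2 : ℚ) = ((2 : ℕ) : ℚ) by norm_num, padicValRat.of_nat,
      padicValNat_self]
    push_cast
    omega
  -- `S = ℤ • 1 + π O₍₂₎`; the residues of `O₍₂₎` modulo `π O₍₂₎` are not all in `{0, 1}`
  set K : Submodule ℤ B := π • localAt 2 O with hK
  have hKΛ : K ≤ localAt 2 O := by
    intro x hx
    rw [hK, mem_units_smul_localAt_iff_of_ramified hdiv hΛ, hπ] at hx
    rcases hx with rfl | hx
    · exact Submodule.zero_mem _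
    · by_cases hx0 : x = 0
      · rw [hx0]; exact Submodule.zero_mem _
      · exact (mem_localAt_iff_padicValRat_of_ramified hΛ _).mpr (by linarith)
  have h2K : (2 : B) ∈ K := by
    rw [hK, mem_units_smul_localAt_iff_of_ramified hdiv hΛ, hπ]
    right
    rw [show (2 : B) = algebraMap ℚ B 2 by rw [map_ofNat], reducedNorm_algebraMap,
      show ((2 : ℚ) ^ 2) = ((4 : ℕ) : ℚ) by norm_num, padicValRat.of_nat]
    have : padicValNat 2 4 = 2 := by
      rw [show (4 : ℕ) = 2 ^ 2 by norm_num, padicValNat.prime_pow]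
    rw [this]; norm_num
  have hexists : ∃ y ∈ localAt 2 O, ∀ n : ℤ, y - n • (1 : B) ∉ K := by
    by_contra hall
    push Not at hall
    -- then every residue of `O₍₂₎` mod `K` is `0` or `1`
    have hsub : (QuotientAddGroup.mk '' (localAt 2 O : Set B) : Set (B ⧸ K.toAddSubgroup)) ⊆
        {QuotientAddGroup.mk 0, QuotientAddGroup.mk 1} := by
      rintro _ ⟨y, hy, rfl⟩
      obtain ⟨n, hn⟩ := hall y hy
      have hy1 : (QuotientAddGroup.mk y : B ⧸ K.toAddSubgroup) = QuotientAddGroup.mk (n • (1 : B)) := by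
        rw [QuotientAddGroup.eq]
        have : -y + n • (1 : B) = -(y - n • 1) := by abel
        rw [this]; exact K.neg_mem hn
      rw [hy1]
      -- `n • 1 ≡ (n % 2) • 1`, and `n % 2 ∈ {0, 1}`
      have h21 : (2 : ℤ) • (1 : B) = 2 := by rw [zsmul_eq_mul, mul_one]; norm_cast
      have hres : (QuotientAddGroup.mk (n • (1 : B)) : B ⧸ K.toAddSubgroup) =
          QuotientAddGroup.mk ((n % 2) • (1 : B)) := by
        rw [QuotientAddGroup.eq, ← neg_smul, ← add_smul]
        have hn : -n + n % 2 = -(n / 2) * 2 := by omega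
        rw [hn, ← smul_smul, h21]
        exact K.smul_mem _ h2K
      rw [hres]
      rcases Int.emod_two_eq_zero_or_one n with h0 | h1
      · left; rw [h0, zero_smul]
      · right; rw [Set.mem_singleton_iff, h1, one_smul]
    have hcard : (QuotientAddGroup.mk '' (localAt 2 O : Set B) : Set (B ⧸ K.toAddSubgroup)).ncard = 2 ^ 2 := by
      rw [show (localAt 2 O : Set B) = ((localAt 2 O).toAddSubgroup : Set B) from rfl, ncard_image_mk_eq_relIndex,
        hK]
      exact relIndex_units_smul_localAt_of_ramified hO hΛ π 1 hπ
    have hle := Set.ncard_le_ncard hsub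
    rw [hcard] at hle
    have h2 : ({QuotientAddGroup.mk 0, QuotientAddGroup.mk 1} : Set (B ⧸ K.toAddSubgroup)).ncard ≤ 2 :=
      (Set.ncard_insert_le _ _).trans (by rw [Set.ncard_singleton])
    omega
  obtain ⟨y, hyΛ, hy⟩ := hexists
  -- `z = y - (t/2) • 1`
  set t := reducedTrace ℚ B y with ht
  obtain ⟨c', hc'⟩ := exists_int_smul_one_sub_mem_of_ramified hdiv hΛ π hπ (heven y hyΛ)
  set z : B := y - (t / 2) • (1 : B) with hz
  have hzΛ : z ∈ localAt 2 O := by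
    rw [hz]
    refine Submodule.sub_mem _ hyΛ ?_
    rw [← Algebra.algebraMap_eq_smul_one]
    exact algebraMap_mem_of_localAt_eq (localAt_localAt 2 O) hO.one_mem_localAt (heven y hyΛ)
  have hznot : ∀ n : ℤ, z - n • (1 : B) ∉ K := by
    intro n hn
    apply hy (c' + n)
    have : y - (c' + n) • (1 : B) = (z - n • 1) + ((t / 2) • (1 : B) - (c' : ℤ) • 1) := by
      rw [hz, add_smul]; abel
    rw [this]
    exact K.add_mem hn hc'
  have htz : reducedTrace ℚ B z = 0 := by
    rw [hz, map_sub, map_smul, reducedTrace_one, smul_eq_mul, ← ht]; ring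
  have hz0 : z ≠ 0 := by
    intro h
    apply hznot 0
    rw [h, zero_smul, sub_zero]; exact K.zero_mem
  have hzK : z ∉ K := by simpa using hznot 0
  -- `v₂(nrd z) = 0`
  have hvz : padicValRat 2 (reducedNorm ℚ B z) = 0 := by
    have h0 := (mem_localAt_iff_padicValRat_of_ramified hΛ z).mp hzΛ
    have h1 : ¬ (1 : ℤ) ≤ padicValRat 2 (reducedNorm ℚ B z) := by
      intro h1
      apply hzK
      rw [hK, mem_units_smul_localAt_iff_of_ramified hdiv hΛ, hπ]
      exact Or.inr (by exact_mod_cast h1)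
    omega
  -- `nrd (z + 1) = nrd z + 1`
  have hnz1 : reducedNorm ℚ B (z + 1) = reducedNorm ℚ B z + 1 := by
    rw [reducedNorm_add ℚ z 1, standardInvolution_one, mul_one, htz, reducedNorm_one ℚ B]; ring
  have hzn0 : reducedNorm ℚ B z ≠ 0 := reducedNorm_ne_zero_of_ne_zero hdiv hz0
  rcases padicValRat_two_add_one (hO.not_dvd_den_reducedNorm_of_mem_localAt hzΛ) hvz hzn0 with h | h
  · -- `nrd (z + 1) = 0`, so `z = -1`
    have hz1 : z + 1 = 0 := by
      by_contra hne
      exact reducedNorm_ne_zero_of_ne_zero hdiv hne (by rw [hnz1, h])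
    apply hznot (-1)
    rw [neg_smul, one_smul, sub_neg_eq_add, hz1]; exact K.zero_mem
  · -- `z + 1 ∈ π O₍₂₎`
    apply hznot (-1)
    rw [neg_smul, one_smul, sub_neg_eq_add, hK, mem_units_smul_localAt_iff_of_ramified hdiv hΛ, hπ, hnz1]
    exact Or.inr (by exact_mod_cast h)

/-! ### The trace dual `π⁻¹ O₍ₚ₎` -/

/-- **The local trace dual at a ramified prime is `π⁻¹ O₍ₚ₎`** (Vignéras II §1 Cor. 1.7:
`O♯ = P⁻¹ = π⁻¹ O`), when `ℚ_p ⊗ B` is a division ring: `trd(x y) ∈ ℤ₍ₚ₎` for all `y ∈ O₍ₚ₎`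
iff `x ∈ π⁻¹ O₍ₚ₎`. [cite: VignerasLNM800, Ch. II §1 Cor. 1.7, Ch. I §4 Lemme 4.7] -/
theorem forall_not_dvd_den_reducedTrace_iff_of_ramified (hT : ∀ y : ℚ_[p] ⊗[ℚ] B, y ≠ 0 → IsUnit y)
    (π : Bˣ) (hπ : padicValRat p (reducedNorm ℚ B (π : B)) = 1) (x : B) :
    (∀ y ∈ localAt p O, ¬ p ∣ (reducedTrace ℚ B (x * y)).den) ↔ x ∈ π⁻¹ • localAt p O := by
  have hpp : p.Prime := hp.out
  haveI : Nontrivial B := IsQuaternionAlgebra.nontrivial_rat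
  have hπinv : padicValRat p (reducedNorm ℚ B ((π⁻¹ : Bˣ) : B)) = -1 := by
    rw [reducedNorm_units_inv, padicValRat.inv, hπ]
  rw [mem_units_smul_localAt_iff_of_ramified hdiv hΛ, hπinv]
  constructor
  · intro h
    by_contra hbad
    push Not at hbad
    obtain ⟨hx0, hv⟩ := hbad
    -- `v_p(nrd x) ≤ -2`; test against `y = p⁻¹ x⁻¹ y₀`
    obtain ⟨y₀, hy₀Λ, ht0, hvt⟩ := exists_padicValRat_reducedTrace_eq_zero_of_ramified hdiv hO hΛ
    have hxn : reducedNorm ℚ B x ≠ 0 := reducedNorm_ne_zero_of_ne_zero hdiv hx0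
    set X := (hdiv x hx0).unit with hX
    have hXv : (X : B) = x := IsUnit.unit_spec _
    have hy₀0 : y₀ ≠ 0 := by rintro rfl; exact ht0 (map_zero _)
    have hy₀n : reducedNorm ℚ B y₀ ≠ 0 := reducedNorm_ne_zero_of_ne_zero hdiv hy₀0
    have hy₀v : 0 ≤ padicValRat p (reducedNorm ℚ B y₀) := (mem_localAt_iff_padicValRat_of_ramified hΛ y₀).mp hy₀Λ
    set y : B := (p : ℚ)⁻¹ • (((X⁻¹ : Bˣ) : B) * y₀) with hy
    have hpQ : (p : ℚ) ≠ 0 := Nat.cast_ne_zero.mpr hpp.ne_zero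
    have hyΛ : y ∈ localAt p O := by
      rw [mem_localAt_iff_padicValRat_of_ramified hΛ, hy, reducedNorm_smul, reducedNorm_mul_holds ℚ B,
        reducedNorm_units_inv, hXv, padicValRat.mul (pow_ne_zero _ (inv_ne_zero hpQ)) (mul_ne_zero (inv_ne_zero hxn) hy₀n),
        padicValRat.pow, padicValRat.inv, padicValRat.self hpp.one_lt,
        padicValRat.mul (inv_ne_zero hxn) hy₀n, padicValRat.inv]
      push_cast
      linarith
    have hxy : x * y = (p : ℚ)⁻¹ • y₀ := by
      rw [hy, mul_smul_comm, ← mul_assoc, ← hXv, Units.mul_inv, one_mul]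
    have htr := h y hyΛ
    rw [hxy, map_smul, smul_eq_mul] at htr
    apply htr
    have hv1 : padicValRat p ((p : ℚ)⁻¹ * reducedTrace ℚ B y₀) = -1 := by
      rw [padicValRat.mul (inv_ne_zero hpQ) ht0, padicValRat.inv, padicValRat.self hpp.one_lt, hvt]; ring
    by_contra hnd
    have := padicValRat_nonneg_of_not_dvd_den hnd
    rw [hv1] at this
    exact absurd this (by norm_num)
  · intro h y hy
    by_cases hxy : x * y = 0
    · rw [hxy, map_zero, ← Int.cast_zero (R := ℚ)]; exact not_dvd_den_intCast hpp 0
    have hx0 : x ≠ 0 := by rintro rfl; exact hxy (zero_mul _)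
    have hy0 : y ≠ 0 := by rintro rfl; exact hxy (mul_zero _)
    rcases h with h | h
    · exact absurd h hx0
    refine not_dvd_den_reducedTrace_of_neg_one_le hT (x * y) (reducedNorm_ne_zero_of_ne_zero hdiv hxy) ?_
    rw [reducedNorm_mul_holds ℚ B, padicValRat.mul (reducedNorm_ne_zero_of_ne_zero hdiv hx0)
      (reducedNorm_ne_zero_of_ne_zero hdiv hy0)]
    have := (mem_localAt_iff_padicValRat_of_ramified hΛ y).mp hy
    linarith

omit [Algebra ℚ B] [IsQuaternionAlgebra ℚ B] hdiv hO hΛ in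
/-- Pointwise translation by a unit is the image under left multiplication. [folklore] -/
theorem units_smul_toAddSubgroup_eq_map (u : Bˣ) (L : Submodule ℤ B) :
    (u • L).toAddSubgroup = L.toAddSubgroup.map (AddMonoidHom.mulLeft (u : B)) := by
  ext x
  constructor
  · intro hx
    obtain ⟨y, hy, rfl⟩ := (Submodule.mem_smul_pointwise_iff_exists x u L).mp hx
    exact ⟨y, hy, rfl⟩
  · rintro ⟨y, hy, rfl⟩
    exact (Submodule.mem_smul_pointwise_iff_exists _ u L).mpr ⟨y, hy, rfl⟩

omit hdiv in
/-- **`[π⁻¹ O₍ₚ₎ : O₍ₚ₎] = p²`** at a ramified prime (Vignéras II §1 Cor. 1.7: `O♯ = π⁻¹ O` and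
`[O : πO] = p²`). [cite: VignerasLNM800, Ch. II §1 Cor. 1.7] -/
theorem relIndex_localAt_inv_uniformizer_smul (π : Bˣ) (hπ : padicValRat p (reducedNorm ℚ B (π : B)) = 1) :
    (localAt p O).toAddSubgroup.relIndex (π⁻¹ • localAt p O).toAddSubgroup = p ^ 2 := by
  have hinj : Function.Injective (AddMonoidHom.mulLeft (π : B)) := fun a b hab => by
    simpa using congrArg (fun w => ((π⁻¹ : Bˣ) : B) * w) hab
  have h := AddSubgroup.relIndex_map_map_of_injective (f := AddMonoidHom.mulLeft (π : B))
    (localAt p O).toAddSubgroup (π⁻¹ • localAt p O).toAddSubgroup hinj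
  rw [← units_smul_toAddSubgroup_eq_map, ← units_smul_toAddSubgroup_eq_map, smul_smul, mul_inv_cancel, one_smul] at h
  rw [← h, relIndex_units_smul_localAt_of_ramified hO hΛ π 1 hπ]

end Ramified

end Literature.NumberTheory.Automorphic
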